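import Literature.Probability.RandomPlanarGeometry.BrownianLoopMeasure
import Literature.Probability.RandomPlanarGeometry.PlanarSausageBound
import Literature.Probability.Process.PathHittingEvents
import Mathlib.MeasureTheory.Measure.Lebesgue.EqHaar
import HarnessLib

/-!
# Brownian loop masses: reduction of `Λ(K₁, K₂; D)` to the unit bridge (rooted side, Tonelli, scaling)

Proof file (theorems only). For the Brownian loop measure of `BrownianLoopMeasure`
(`base = area ⊗ 𝟙_{t>0} dt/(2πt²) ⊗ ℙ`, rooted loop `γ_{z,t,ω}(u) = z + √t b_u(ω)`,
`b_u = Z_u − u Z_1` the unit bridge) we carry out the measure-theoretic reduction of the loop mass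
`Λ(K₁, K₂; D) = μ^loop_D(hit K₁ ∩ hit K₂)` used to prove its finiteness:

* `loopMass_le_base_bridgeEvent` — **`Λ(K₁, K₂; D) ≤ base(E)`** for the rooted event
  `E = {(z, t, ω) : (∃ s ≤ 1, z + √t b_s ∈ K̄₁) ∧ (∃ s ≤ 1, z + √t b_s ∈ K̄₂) ∧ ∀ s ≤ 1, z + √t b_s ∉ O}`
  when `D` is open and misses the open set `O` (`brownianLoopMeasure_apply`);
* `measurableSet_bridgeEvent` — `E` is measurable (countable description of hitting events,
  `Process.measurableSet_exists_le_mem`);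
* `base_bridgeEvent_eq_lintegral` — **Tonelli**:
  `base(E) = ∫_{t>0} (1/(2πt²)) E_ω[ |E_{t,ω}| ] dt`, `E_{t,ω}` the `z`-section;
* `volume_section_eq_mul_volume_scaled` — **Brownian scaling of the root**:
  `|E_{t,ω}| = t · |{w : (∃ s ≤ 1, w + b_s ∈ t^{-1/2} K̄₁) ∧ … }|` (`z = √t w`, `Measure.addHaar_smul`);
* `volume_scaled_le_of_small` — the deterministic bound for SMALL loops: if `K̄₁ ⊆ B̄(0, R)` and
  `dist(K̄₁, K̄₂) ≥ δ`, then `(1/(2πt²)) · t · |{w : …}| ≤ (2¹² R²/δ⁴ + 2¹⁰/δ²) m⁴` with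
  `m = max (runSup 1 ω₁) (runSup 1 ω₂)` (a loop hitting both sets has amplitude `≥ δ/(8√t)` in the
  unit picture, and its root lies within `R/√t + 4m` of the origin).

No definition and no named fact is introduced.

## References

* G. F. Lawler, W. Werner, *The Brownian loop soup*, PTRF 128 (2004), §4.1. [LawlerWerner2004]
* G. F. Lawler, *Partition functions, loop measure, and versions of SLE*, J. Stat. Phys. 134 (2009),
  §2.2. [Lawler2009]
-/

noncomputable section

open MeasureTheory ProbabilityTheory Filter Set Metric Complex
open scoped NNReal ENNReal Topology unitInterval Pointwise

namespace Literature.Probability.RandomPlanarGeometry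

open Literature.Probability.Process
open BrownianLoop UnbasedLoop

/-! ### The rooted loop read through the bridge at real times -/

/-- The rooted loop at the point `u ∈ [0, 1]` is `z + √t b_s` with `s = u` read in `ℝ≥0`.
[folklore] -/
theorem rootedFun_eq_bridge (p : ℂ × ℝ × WienerPair) (u : I) :
    rootedFun p u = p.1 + (Real.sqrt p.2.1 : ℂ) *
      (planarBrownian (timeOf u) p.2.2 - ((timeOf u : ℝ≥0) : ℝ) • planarBrownian 1 p.2.2) := rfl

/-- A time `s ≤ 1` as a point of the unit interval. [folklore] -/
theorem timeOf_mk {s : ℝ≥0} (hs : s ≤ 1) : timeOf ⟨(s : ℝ), s.coe_nonneg, by exact_mod_cast hs⟩ = s := rfl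

/-- The loop map `(s, (z, t, ω)) ↦ z + √t b_s(ω)` is measurable in `(z, t, ω)`. [folklore] -/
theorem measurable_bridgeLoop (s : ℝ≥0) :
    Measurable fun p : ℂ × ℝ × WienerPair ↦ p.1 + (Real.sqrt p.2.1 : ℂ) *
      (planarBrownian s p.2.2 - (s : ℝ) • planarBrownian 1 p.2.2) := by
  refine measurable_fst.add ((Complex.measurable_ofReal.comp
    (Real.continuous_sqrt.measurable.comp (measurable_fst.comp measurable_snd))).mul ?_)
  exact ((measurable_planarBrownian s).comp (measurable_snd.comp measurable_snd)).sub
    (((measurable_planarBrownian 1).comp (measurable_snd.comp measurable_snd)).const_smul (s : ℝ))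

/-- The loop map is continuous in the time `s`. [folklore] -/
theorem continuous_bridgeLoop (p : ℂ × ℝ × WienerPair) :
    Continuous fun s : ℝ≥0 ↦ p.1 + (Real.sqrt p.2.1 : ℂ) *
      (planarBrownian s p.2.2 - (s : ℝ) • planarBrownian 1 p.2.2) :=
  continuous_const.add (continuous_const.mul ((continuous_planarBrownian p.2.2).sub
    (NNReal.continuous_coe.smul continuous_const)))

/-- **The rooted event is measurable.** [folklore] -/
theorem measurableSet_bridgeEvent {K K' O : Set ℂ} (hK : IsClosed K) (hK' : IsClosed K') (hO : IsOpen O) :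
    MeasurableSet {p : ℂ × ℝ × WienerPair |
      (∃ s : ℝ≥0, s ≤ 1 ∧ p.1 + (Real.sqrt p.2.1 : ℂ) * (planarBrownian s p.2.2 - (s : ℝ) • planarBrownian 1 p.2.2) ∈ K) ∧
      (∃ s : ℝ≥0, s ≤ 1 ∧ p.1 + (Real.sqrt p.2.1 : ℂ) * (planarBrownian s p.2.2 - (s : ℝ) • planarBrownian 1 p.2.2) ∈ K') ∧
      ∀ s : ℝ≥0, s ≤ 1 → p.1 + (Real.sqrt p.2.1 : ℂ) * (planarBrownian s p.2.2 - (s : ℝ) • planarBrownian 1 p.2.2) ∉ O} := by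
  have h1 := measurableSet_exists_le_mem (Φ := fun (s : ℝ≥0) (p : ℂ × ℝ × WienerPair) ↦
    p.1 + (Real.sqrt p.2.1 : ℂ) * (planarBrownian s p.2.2 - (s : ℝ) • planarBrownian 1 p.2.2))
    measurable_bridgeLoop continuous_bridgeLoop hK 1
  have h2 := measurableSet_exists_le_mem (Φ := fun (s : ℝ≥0) (p : ℂ × ℝ × WienerPair) ↦
    p.1 + (Real.sqrt p.2.1 : ℂ) * (planarBrownian s p.2.2 - (s : ℝ) • planarBrownian 1 p.2.2))
    measurable_bridgeLoop continuous_bridgeLoop hK' 1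
  have h3 := measurableSet_forall_notMem (Φ := fun (s : ℝ≥0) (p : ℂ × ℝ × WienerPair) ↦
    p.1 + (Real.sqrt p.2.1 : ℂ) * (planarBrownian s p.2.2 - (s : ℝ) • planarBrownian 1 p.2.2))
    measurable_bridgeLoop continuous_bridgeLoop hO 1
  exact h1.inter (h2.inter h3)

/-! ### `Λ ≤ base(E)` -/

/-- **The loop mass is dominated by the base measure of the rooted event.** For `D` open and
disjoint from the open set `O`, and closed `K, K'`,
`Λ(K, K'; D) ≤ base {(z,t,ω) : (∃ s ≤ 1, γ(s) ∈ K) ∧ (∃ s ≤ 1, γ(s) ∈ K') ∧ ∀ s ≤ 1, γ(s) ∉ O}`,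
`γ(s) = z + √t b_s(ω)`. [cite: LawlerWerner2004, §4.1] -/
theorem loopMass_le_base_bridgeEvent {D K K' O : Set ℂ} (hD : IsOpen D) (hDO : Disjoint O D)
    (hK : IsClosed K) (hK' : IsClosed K') :
    loopMass D K K' ≤ base {p : ℂ × ℝ × WienerPair |
      (∃ s : ℝ≥0, s ≤ 1 ∧ p.1 + (Real.sqrt p.2.1 : ℂ) * (planarBrownian s p.2.2 - (s : ℝ) • planarBrownian 1 p.2.2) ∈ K) ∧
      (∃ s : ℝ≥0, s ≤ 1 ∧ p.1 + (Real.sqrt p.2.1 : ℂ) * (planarBrownian s p.2.2 - (s : ℝ) • planarBrownian 1 p.2.2) ∈ K') ∧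
      ∀ s : ℝ≥0, s ≤ 1 → p.1 + (Real.sqrt p.2.1 : ℂ) * (planarBrownian s p.2.2 - (s : ℝ) • planarBrownian 1 p.2.2) ∉ O} := by
  rw [loopMass, brownianLoopMeasure_apply hD ((measurableSet_hit_of_isClosed hK).inter (measurableSet_hit_of_isClosed hK'))]
  refine measure_mono fun p ⟨⟨h1, h2⟩, hrange⟩ ↦ ⟨?_, ?_, fun s hs hsO ↦ ?_⟩
  · obtain ⟨x, ⟨u, rfl⟩, hxK⟩ := (mem_hit.1 h1)
    refine ⟨timeOf u, by exact_mod_cast u.2.2, ?_⟩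
    have : (rooted p : I → ℂ) u ∈ K := hxK
    rwa [rooted_apply] at this
  · obtain ⟨x, ⟨u, rfl⟩, hxK⟩ := (mem_hit.1 h2)
    refine ⟨timeOf u, by exact_mod_cast u.2.2, ?_⟩
    have : (rooted p : I → ℂ) u ∈ K' := hxK
    rwa [rooted_apply] at this
  · have hmem : p.1 + (Real.sqrt p.2.1 : ℂ) * (planarBrownian s p.2.2 - (s : ℝ) • planarBrownian 1 p.2.2) ∈
        (rooted p).range := by
      refine ⟨⟨(s : ℝ), s.coe_nonneg, by exact_mod_cast hs⟩, ?_⟩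
      rw [rooted_apply]
      rfl
    exact Set.disjoint_left.1 hDO hsO (hrange hmem)

/-! ### Tonelli -/

/-- **Tonelli for the base measure**: for a measurable rooted event `E`,
`base(E) = ∫_{t>0} (1/(2πt²)) (∫ |E_{t,ω}| dℙ(ω)) dt` (`E_{t,ω}` the `z`-section; the area of the
`z`-sections is measurable in `(t, ω)` by Mathlib's `measurable_measure_prodMk_right`).
[cite: LawlerWerner2004, §4.1] -/
theorem base_eq_lintegral {E : Set (ℂ × ℝ × WienerPair)} (hE : MeasurableSet E) :
    base E = ∫⁻ t in Ioi 0, timeDensity t * ∫⁻ ω, volume ((fun z : ℂ ↦ (z, (t, ω))) ⁻¹' E) ∂wienerPair := by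
  rw [base, Measure.prod_apply_symm hE, lintegral_prod _ (measurable_measure_prodMk_right hE).aemeasurable,
    timeMeasure, lintegral_withDensity_eq_lintegral_mul _ measurable_timeDensity]
  · rfl
  · exact (measurable_measure_prodMk_right hE).lintegral_prod_right'

/-! ### Scaling of the root -/

/-- **Brownian scaling of the root.** For `t > 0`, the set of roots `z` with
`(∃ s ≤ 1, z + √t b_s ∈ K) ∧ (∃ s ≤ 1, z + √t b_s ∈ K') ∧ ∀ s ≤ 1, z + √t b_s ∉ O` is `√t` times the
set of `w` with the same property for the sets `t^{-1/2} K, t^{-1/2} K', t^{-1/2} O`, so its area is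
`t` times the area of the latter (`Measure.addHaar_smul`). [folklore] -/
theorem volume_section_eq_mul_volume_scaled (K K' O : Set ℂ) {t : ℝ} (ht : 0 < t) (ω : WienerPair) :
    volume {z : ℂ | (∃ s : ℝ≥0, s ≤ 1 ∧ z + (Real.sqrt t : ℂ) * (planarBrownian s ω - (s : ℝ) • planarBrownian 1 ω) ∈ K) ∧
      (∃ s : ℝ≥0, s ≤ 1 ∧ z + (Real.sqrt t : ℂ) * (planarBrownian s ω - (s : ℝ) • planarBrownian 1 ω) ∈ K') ∧
      ∀ s : ℝ≥0, s ≤ 1 → z + (Real.sqrt t : ℂ) * (planarBrownian s ω - (s : ℝ) • planarBrownian 1 ω) ∉ O} =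
    ENNReal.ofReal t * volume {w : ℂ |
      (∃ s : ℝ≥0, s ≤ 1 ∧ w + (planarBrownian s ω - (s : ℝ) • planarBrownian 1 ω) ∈ (Real.sqrt t)⁻¹ • K) ∧
      (∃ s : ℝ≥0, s ≤ 1 ∧ w + (planarBrownian s ω - (s : ℝ) • planarBrownian 1 ω) ∈ (Real.sqrt t)⁻¹ • K') ∧
      ∀ s : ℝ≥0, s ≤ 1 → w + (planarBrownian s ω - (s : ℝ) • planarBrownian 1 ω) ∉ (Real.sqrt t)⁻¹ • O} := by
  set c : ℝ := Real.sqrt t with hc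
  have hc0 : c ≠ 0 := (Real.sqrt_pos.2 ht).ne'
  set bp : ℝ≥0 → ℂ := fun s ↦ planarBrownian s ω - (s : ℝ) • planarBrownian 1 ω with hbp
  -- the key pointwise equivalence: `z + c b ∈ S ↔ c⁻¹ z + b ∈ c⁻¹ S`
  have key : ∀ (S : Set ℂ) (z : ℂ) (s : ℝ≥0), z + (c : ℂ) * bp s ∈ S ↔ c⁻¹ • z + bp s ∈ c⁻¹ • S := by
    intro S z s
    rw [Set.mem_smul_set_iff_inv_smul_mem₀ (inv_ne_zero hc0), inv_inv]
    have : c • (c⁻¹ • z + bp s) = z + (c : ℂ) * bp s := by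
      rw [smul_add, smul_smul, mul_inv_cancel₀ hc0, one_smul, real_smul]
    rw [this]
  have hset : {z : ℂ | (∃ s : ℝ≥0, s ≤ 1 ∧ z + (c : ℂ) * bp s ∈ K) ∧ (∃ s : ℝ≥0, s ≤ 1 ∧ z + (c : ℂ) * bp s ∈ K') ∧
      ∀ s : ℝ≥0, s ≤ 1 → z + (c : ℂ) * bp s ∉ O} =
      c • {w : ℂ | (∃ s : ℝ≥0, s ≤ 1 ∧ w + bp s ∈ c⁻¹ • K) ∧ (∃ s : ℝ≥0, s ≤ 1 ∧ w + bp s ∈ c⁻¹ • K') ∧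
        ∀ s : ℝ≥0, s ≤ 1 → w + bp s ∉ c⁻¹ • O} := by
    ext z
    rw [Set.mem_smul_set_iff_inv_smul_mem₀ hc0]
    simp only [mem_setOf_eq, key]
  rw [hset, Measure.addHaar_smul, Complex.finrank_real_complex]
  congr 1
  rw [hc, abs_of_nonneg (by positivity), Real.sq_sqrt ht.le]

/-! ### Small loops -/

/-- The bridge stays within `4 max runSup`: `|b_s(ω)| ≤ 4 max (runSup 1 ω₁) (runSup 1 ω₂)` for
`s ≤ 1`. [folklore] -/
theorem norm_bridge_le {s : ℝ≥0} (hs : s ≤ 1) (ω : WienerPair) :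
    ‖planarBrownian s ω - (s : ℝ) • planarBrownian 1 ω‖ ≤ 4 * max (runSup 1 ω.1) (runSup 1 ω.2) := by
  have h1 := norm_planarBrownian_le_two_mul_max_runSup hs ω
  have h2 := norm_planarBrownian_le_two_mul_max_runSup (le_refl (1 : ℝ≥0)) ω
  have hs' : (s : ℝ) ≤ 1 := by exact_mod_cast hs
  have hm : 0 ≤ max (runSup 1 ω.1) (runSup 1 ω.2) := max_runSup_nonneg 1 ω
  calc ‖planarBrownian s ω - (s : ℝ) • planarBrownian 1 ω‖
      ≤ ‖planarBrownian s ω‖ + ‖(s : ℝ) • planarBrownian 1 ω‖ := norm_sub_le _ _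
    _ = ‖planarBrownian s ω‖ + (s : ℝ) * ‖planarBrownian 1 ω‖ := by
        rw [norm_smul, Real.norm_eq_abs, abs_of_nonneg s.coe_nonneg]
    _ ≤ 2 * max (runSup 1 ω.1) (runSup 1 ω.2) + 1 * (2 * max (runSup 1 ω.1) (runSup 1 ω.2)) := by
        gcongr
    _ = 4 * max (runSup 1 ω.1) (runSup 1 ω.2) := by ring

/-- **The deterministic bound for small loops.** Let `K ⊆ B̄(0, R)` (`R ≥ 0`) and `K'` be at
distance `≥ δ > 0` from `K`. For `t > 0` and every sample `ω`, writing
`m = max (runSup 1 ω₁) (runSup 1 ω₂)`,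

  `(1/(2πt²)) · t · |{w : (∃ s ≤ 1, w + b_s ∈ t^{-1/2}K) ∧ (∃ s ≤ 1, w + b_s ∈ t^{-1/2}K') ∧ …}|`
    `≤ (2¹² R²/δ⁴ + 2¹⁰/δ²) m⁴`:

if the set is nonempty then `|b_s − b_{s'}| ≥ δ/√t` for some `s, s'`, so `δ ≤ 8m√t`, and the set
lies in `B̄(0, R/√t + 4m)`. [folklore] -/
theorem volume_scaled_le_of_small {K K' : Set ℂ} (O : Set ℂ) {R δ : ℝ} (hR : 0 ≤ R) (hδ : 0 < δ)
    (hKR : K ⊆ closedBall 0 R) (hdist : ∀ x ∈ K, ∀ y ∈ K', δ ≤ dist x y) {t : ℝ} (ht : 0 < t) (ω : WienerPair) :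
    timeDensity t * (ENNReal.ofReal t * volume {w : ℂ |
      (∃ s : ℝ≥0, s ≤ 1 ∧ w + (planarBrownian s ω - (s : ℝ) • planarBrownian 1 ω) ∈ (Real.sqrt t)⁻¹ • K) ∧
      (∃ s : ℝ≥0, s ≤ 1 ∧ w + (planarBrownian s ω - (s : ℝ) • planarBrownian 1 ω) ∈ (Real.sqrt t)⁻¹ • K') ∧
      ∀ s : ℝ≥0, s ≤ 1 → w + (planarBrownian s ω - (s : ℝ) • planarBrownian 1 ω) ∉ (Real.sqrt t)⁻¹ • O}) ≤
    ENNReal.ofReal ((2 ^ 12 * R ^ 2 / δ ^ 4 + 2 ^ 10 / δ ^ 2) * max (runSup 1 ω.1) (runSup 1 ω.2) ^ 4) := by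
  set m : ℝ := max (runSup 1 ω.1) (runSup 1 ω.2) with hm
  have hm0 : 0 ≤ m := max_runSup_nonneg 1 ω
  set c : ℝ := Real.sqrt t with hc
  have hc0 : 0 < c := Real.sqrt_pos.2 ht
  set ε : ℝ := c⁻¹ with hε
  have hε0 : 0 < ε := inv_pos.2 hc0
  set bp : ℝ≥0 → ℂ := fun s ↦ planarBrownian s ω - (s : ℝ) • planarBrownian 1 ω with hbp
  have hbp4 : ∀ s : ℝ≥0, s ≤ 1 → ‖bp s‖ ≤ 4 * m := fun s hs ↦ norm_bridge_le hs ω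
  set S : Set ℂ := {w : ℂ | (∃ s : ℝ≥0, s ≤ 1 ∧ w + bp s ∈ ε • K) ∧ (∃ s : ℝ≥0, s ≤ 1 ∧ w + bp s ∈ ε • K') ∧
    ∀ s : ℝ≥0, s ≤ 1 → w + bp s ∉ ε • O} with hS
  -- elements of the scaled sets
  have hmemK : ∀ x ∈ ε • K, ‖x‖ ≤ ε * R := by
    rintro _ ⟨y, hy, rfl⟩
    rw [norm_smul, Real.norm_eq_abs, abs_of_pos hε0]
    exact mul_le_mul_of_nonneg_left (by simpa [mem_closedBall, dist_zero_right] using hKR hy) hε0.le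
  have hdist' : ∀ x ∈ ε • K, ∀ y ∈ ε • K', ε * δ ≤ dist x y := by
    rintro _ ⟨x, hx, rfl⟩ _ ⟨y, hy, rfl⟩
    rw [dist_smul₀, Real.norm_eq_abs, abs_of_pos hε0]
    exact mul_le_mul_of_nonneg_left (hdist x hx y hy) hε0.le
  -- case: the set is empty unless `ε δ ≤ 8 m`
  by_cases hbig : ε * δ ≤ 8 * m
  · -- the set lies in the disc of radius `ε R + 4 m`
    have hsub : S ⊆ closedBall 0 (ε * R + 4 * m) := by
      rintro w ⟨⟨s, hs, hw⟩, -, -⟩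
      rw [mem_closedBall, dist_zero_right]
      calc ‖w‖ = ‖(w + bp s) - bp s‖ := by rw [add_sub_cancel_right]
        _ ≤ ‖w + bp s‖ + ‖bp s‖ := norm_sub_le _ _
        _ ≤ ε * R + 4 * m := add_le_add (hmemK _ hw) (hbp4 s hs)
    have hpiE : (NNReal.pi : ℝ≥0∞) = ENNReal.ofReal Real.pi := by
      rw [← ENNReal.ofReal_coe_nnreal, NNReal.coe_real_pi]
    have hvol : volume S ≤ ENNReal.ofReal ((ε * R + 4 * m) ^ 2) * ENNReal.ofReal Real.pi := by
      refine (measure_mono hsub).trans (le_of_eq ?_)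
      rw [Complex.volume_closedBall, ENNReal.ofReal_pow (by positivity), hpiE]
    -- `1/t ≤ 64 m²/δ²`
    have hinv : t⁻¹ ≤ 64 * m ^ 2 / δ ^ 2 := by
      have h1 : ε * δ ≤ 8 * m := hbig
      have h2 : (ε * δ) ^ 2 ≤ (8 * m) ^ 2 := pow_le_pow_left₀ (by positivity) h1 2
      have h3 : ε ^ 2 = t⁻¹ := by rw [hε, hc, inv_pow, Real.sq_sqrt ht.le]
      rw [mul_pow, h3] at h2
      rw [le_div_iff₀ (by positivity)]
      nlinarith
    rw [timeDensity]
    calc ENNReal.ofReal (1 / (2 * Real.pi * t ^ 2)) * (ENNReal.ofReal t * volume S)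
        ≤ ENNReal.ofReal (1 / (2 * Real.pi * t ^ 2)) * (ENNReal.ofReal t *
            (ENNReal.ofReal ((ε * R + 4 * m) ^ 2) * ENNReal.ofReal Real.pi)) := by gcongr
      _ = ENNReal.ofReal (1 / (2 * Real.pi * t ^ 2) * (t * ((ε * R + 4 * m) ^ 2 * Real.pi))) := by
          rw [← ENNReal.ofReal_mul (by positivity), ← ENNReal.ofReal_mul ht.le, ← ENNReal.ofReal_mul (by positivity)]
      _ ≤ ENNReal.ofReal ((2 ^ 12 * R ^ 2 / δ ^ 4 + 2 ^ 10 / δ ^ 2) * m ^ 4) := by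
          refine ENNReal.ofReal_le_ofReal ?_
          have hpi : 0 < Real.pi := Real.pi_pos
          have h1 : 1 / (2 * Real.pi * t ^ 2) * (t * ((ε * R + 4 * m) ^ 2 * Real.pi)) = (ε * R + 4 * m) ^ 2 / (2 * t) := by
            field_simp
          rw [h1]
          have h2 : (ε * R + 4 * m) ^ 2 ≤ 2 * (ε * R) ^ 2 + 2 * (4 * m) ^ 2 := by nlinarith [sq_nonneg (ε * R - 4 * m)]
          have h3 : (ε * R) ^ 2 = R ^ 2 * t⁻¹ := by rw [mul_pow, hε, hc, inv_pow, Real.sq_sqrt ht.le]; ring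
          calc (ε * R + 4 * m) ^ 2 / (2 * t) ≤ (2 * (ε * R) ^ 2 + 2 * (4 * m) ^ 2) / (2 * t) :=
                div_le_div_of_nonneg_right h2 (by positivity)
            _ = (R ^ 2 * t⁻¹ + 16 * m ^ 2) * t⁻¹ := by rw [h3]; field_simp; ring
            _ ≤ (R ^ 2 * (64 * m ^ 2 / δ ^ 2) + 16 * m ^ 2) * (64 * m ^ 2 / δ ^ 2) := by
                apply mul_le_mul _ hinv (by positivity) (by positivity)
                gcongr
            _ = (2 ^ 12 * R ^ 2 / δ ^ 4 + 2 ^ 10 / δ ^ 2) * m ^ 4 := by field_simp; ring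
  · -- the set is empty
    have hempty : S = ∅ := by
      ext w
      simp only [hS, mem_setOf_eq, mem_empty_iff_false, iff_false, not_and]
      rintro ⟨s, hs, hw⟩ ⟨s', hs', hw'⟩ _
      apply hbig
      have h1 := hdist' _ hw _ hw'
      rw [dist_eq_norm] at h1
      calc ε * δ ≤ ‖(w + bp s) - (w + bp s')‖ := h1
        _ = ‖bp s - bp s'‖ := by congr 1; abel
        _ ≤ ‖bp s‖ + ‖bp s'‖ := norm_sub_le _ _
        _ ≤ 4 * m + 4 * m := add_le_add (hbp4 s hs) (hbp4 s' hs')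
        _ = 8 * m := by ring
    rw [hempty, measure_empty, mul_zero, mul_zero]
    exact bot_le

end Literature.Probability.RandomPlanarGeometry

end
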